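import Literature.AlgebraicGeometry.Resolution.PthRootGeneratorsValuation
import HarnessLib

/-!
# The charge of a degree-`p` purely inseparable extension along a prime divisor is intrinsic

Topic: `Literature/AlgebraicGeometry/Resolution` (Kummer / Artin–Schreier bookkeeping for purely
inseparable extensions of degree `p` in characteristic `p`). Let `R` be a discrete valuation ring
with uniformizer `ϖ`, fraction field `K` of characteristic `p`, and `L | K` of degree `p`. Call a
`p`-th-root generator `y ∈ L ∖ K` of `L` with CLEAN radicand `y^p = e ϖ^n` (`e ∈ Rˣ`) *charged* if
`p ∤ n` and *uncharged* if `n = 0`. This file proves that the two cases exclude each other as soon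
as the uncharged radicand has a residue which is NOT a `p`-th power (the "wound / transversal"
condition of regular-type clean points):

* `not_charged_and_uncharged` — there are no `y, y' ∈ L`, `y ∉ K`, with `y^p = e ϖ^n`, `p ∤ n`, and
  `y'^p = e'` (`e, e'` units) such that `d^p e' - c^p ∉ 𝔪_R` for all `c ∈ R`, `d ∈ R ∖ 𝔪_R`;
* `charge_iff` — for two clean generators `y_k^p = e_k ϖ^{n_k}` (`k = 1, 2`) with
  `n_k = 0 ∨ p ∤ n_k`, `y_k ∉ K`, and the non-`p`-th-power condition whenever `n_k = 0`:
  `n₁ = 0 ↔ n₂ = 0`.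

Proof: by `exists_residue_pow_mul_eq_of_pth_roots` (`PthRootGeneratorsValuation.lean`) applied to
the charged generator `y` and to `y'`, `0 = n' = p m + j n` with `j < p`, so `p ∣ j`, `j = 0`, and
the residue identity `d̄^p ē' = c̄^p ē^0` says `d^p e' - c^p ∈ 𝔪_R` — excluded.

## Sources

Folklore (the ramification index `e ∈ {1, p}` of a degree-`p` purely inseparable extension along a
discrete valuation is read off any clean `p`-th-root generator; cf. V. Cossart, O. Piltant,
*Resolution of singularities of threefolds in positive characteristic I*, J. Algebra 320 (2008),
hyperbolic vs. wound points). [CossartPiltant2008] Everything here is proved from Mathlib and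
`PthRootGeneratorsValuation.lean`.

## Not here

The case `p ∣ n ≠ 0` (absorb `ϖ^{n/p}` into `y` first), and anything about the residue extension.
-/

noncomputable section

open IsLocalRing

namespace Literature.AlgebraicGeometry.Resolution

variable {R K L : Type*} [CommRing R] [IsDomain R] [IsDiscreteValuationRing R] [Field K]
  [Algebra R K] [IsFractionRing R K] [Field L] [Algebra K L] [Algebra R L] [IsScalarTower R K L]

/-- **A charged and an uncharged clean generator cannot coexist.** Let `R` be a discrete
valuation ring with uniformizer `ϖ` and fraction field `K` of characteristic `p`, `[L : K] = p`.
There are no `y ∈ L ∖ K` with `y^p = e ϖ^n`, `e ∈ Rˣ`, `p ∤ n` (charged) and `y' ∈ L` with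
`y'^p = e'`, `e' ∈ Rˣ` (uncharged) such that `d^p e' - c^p ∉ 𝔪_R` for all `c ∈ R` and all
`d ∈ R ∖ 𝔪_R` (the residue of `e'` is not a `p`-th power). [folklore] -/
theorem not_charged_and_uncharged {p : ℕ} (hp : p.Prime) [CharP K p]
    (hdeg : Module.finrank K L = p) {ϖ : R} (hϖ : Irreducible ϖ) (e e' : Rˣ) (n : ℕ)
    (hn : ¬ p ∣ n) (y y' : L) (hy : y ∉ Set.range (algebraMap K L))
    (hyp : y ^ p = algebraMap R L (e * ϖ ^ n)) (hyp' : y' ^ p = algebraMap R L e')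
    (hNP : ∀ c d : R, d ∉ maximalIdeal R → d ^ p * e' - c ^ p ∉ maximalIdeal R) : False := by
  have hyp'' : y' ^ p = algebraMap R L (e' * ϖ ^ 0) := by rw [pow_zero, mul_one, hyp']
  obtain ⟨j, m, c, d, hj, hn', hd, hres⟩ :=
    exists_residue_pow_mul_eq_of_pth_roots hp hdeg hϖ e e' n 0 hn y y' hy hyp hyp''
  -- `0 = p m + j n` with `p ∤ n`, `j < p` forces `j = 0`
  have hj0 : j = 0 := by
    have h1 : (p : ℤ) ∣ (j : ℤ) * n := ⟨-m, by push_cast at hn'; linear_combination -hn'⟩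
    have h2 : p ∣ j * n := by exact_mod_cast h1
    rcases (Nat.Prime.dvd_mul hp).mp h2 with h3 | h3
    · exact Nat.eq_zero_of_dvd_of_lt h3 hj
    · exact absurd h3 hn
  rw [hj0, pow_zero, mul_one] at hres
  -- the residue identity says `d^p e' - c^p ∈ 𝔪_R`
  refine hNP c d hd ?_
  rw [← residue_eq_zero_iff, map_sub, map_mul, map_pow, map_pow, hres, sub_self]

/-- **The charge along a prime divisor is intrinsic.** Let `R` be a discrete valuation ring with
uniformizer `ϖ` and fraction field `K` of characteristic `p`, `[L : K] = p`, and for `k = 1, 2` let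
`y_k ∈ L ∖ K` be clean generators, `y_k^p = e_k ϖ^{n_k}` with `e_k ∈ Rˣ` and `n_k = 0 ∨ p ∤ n_k`,
such that whenever `n_k = 0` the residue of `e_k` is not a `p`-th power
(`d^p e_k - c^p ∉ 𝔪_R` for `d ∉ 𝔪_R`). Then `n₁ = 0 ↔ n₂ = 0`: both generators are charged or
both are uncharged. [folklore] -/
theorem charge_iff {p : ℕ} (hp : p.Prime) [CharP K p] (hdeg : Module.finrank K L = p) {ϖ : R}
    (hϖ : Irreducible ϖ) (e₁ e₂ : Rˣ) (n₁ n₂ : ℕ) (hn₁ : n₁ = 0 ∨ ¬ p ∣ n₁)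
    (hn₂ : n₂ = 0 ∨ ¬ p ∣ n₂) (y₁ y₂ : L) (hy₁ : y₁ ∉ Set.range (algebraMap K L))
    (hy₂ : y₂ ∉ Set.range (algebraMap K L)) (hyp₁ : y₁ ^ p = algebraMap R L (e₁ * ϖ ^ n₁))
    (hyp₂ : y₂ ^ p = algebraMap R L (e₂ * ϖ ^ n₂))
    (hNP₁ : n₁ = 0 → ∀ c d : R, d ∉ maximalIdeal R → d ^ p * e₁ - c ^ p ∉ maximalIdeal R)
    (hNP₂ : n₂ = 0 → ∀ c d : R, d ∉ maximalIdeal R → d ^ p * e₂ - c ^ p ∉ maximalIdeal R) :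
    n₁ = 0 ↔ n₂ = 0 := by
  constructor
  · intro h1
    by_contra h2
    have hn₂' : ¬ p ∣ n₂ := hn₂.resolve_left h2
    have hyp₁' : y₁ ^ p = algebraMap R L e₁ := by rw [hyp₁, h1, pow_zero, mul_one]
    exact not_charged_and_uncharged hp hdeg hϖ e₂ e₁ n₂ hn₂' y₂ y₁ hy₂ hyp₂ hyp₁' (hNP₁ h1)
  · intro h2
    by_contra h1
    have hn₁' : ¬ p ∣ n₁ := hn₁.resolve_left h1
    have hyp₂' : y₂ ^ p = algebraMap R L e₂ := by rw [hyp₂, h2, pow_zero, mul_one]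
    exact not_charged_and_uncharged hp hdeg hϖ e₁ e₂ n₁ hn₁' y₁ y₂ hy₁ hyp₁ hyp₂' (hNP₂ h2)

end Literature.AlgebraicGeometry.Resolution

end
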